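import Summits.ValiantsHypothesis.ValiantsHypothesis.Theorems.KPlusLogSqLawStaticTridiagonalDefiniteInterval
import Summits.ValiantsHypothesis.ValiantsHypothesis.Theorems.KPlusLogSqLawStaticTridiagonalAlternatingPivots

/-!
# Static definite tridiagonal designs: the MAXIMALLY-INDEFINITE-INTERVAL THEOREM (all sizes) and the
# TOP-CLASS LAW «at most two positive determinant zeros in the top inertia class» (even sizes) — Part 3b

HONEST FRAMING.  Helper theorems (`--supports stmt-ValiantsHypothesis-19561 --as helper`; seat val-sym-lift-p2 g9, cell
`pub-symmetroid`, 2026-08-27) on the REAL side of the desk's typed α target (lead R2102/R2114): «a real symmetric TRIDIAGONAL matrix of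
MONOMIALS `c i j · X ^ (e i j)` with POSITIVE DIAGONAL COEFFICIENTS has at most `C·m + C₀` distinct positive determinant zeros».  That
target is NOT proved here.  This file completes the picture of the EXTREME inertia classes in the decomposition `Z = Σ_j Z_j` of the
positive zeros (`Z_j` = zeros at which the singular matrix has exactly `j` negative eigenvalues): Part 2
(`…StaticTridiagonalDefiniteInterval`) proved the BOTTOM-CLASS LAW `Z₀ ≤ 2` (all `m`); here the TOP-CLASS LAW `Z_(n−1) ≤ 2` for EVEN
`m = 2n` — so for every even size both extreme classes carry at most two zeros each (e.g. an irreducible `4 × 4` design has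
`Z = Z₀ + Z₁ ≤ 4`; the located sharp value is `3`).  Located context (this seat, pure-python inertia walks; not claimed in the kernel):
the MIDDLE classes are not bounded by `2` (the kernel `6 × 6` witness of `…StaticTridiagonalDefiniteSix` has all six zeros in the middle
class), and for ODD `m` the top level is a union of several pivot patterns and its class does exceed `2` (`m = 5`: `(Z₀, Z₁) = (2, 3)`), so
the evenness hypothesis is essential.  Nothing here bears on `WeakLifting` (stmt-19561) / `TropicalB` (stmt-19771) in their windows, on
Conjecture B, the Door-A registers, `MatrixDescartes` (stmt-ValiantsHypothesis-18050) or VP ≠ VNP.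

WHAT IS PROVED (Part 3a = `…StaticTridiagonalAlternatingPivots`: on the alternating pattern odd pivots are log-convex, even ones log-concave).
1. `pivotSign_of_minorSign`, `minorSign_of_pivotSign` — Jacobi bookkeeping: `(−1)^⌊k/2⌋ Δ_k > 0 (k ≤ K)` ⟺ `(−1)^k Δ_{k+1}/Δ_k > 0 (k < K)`.
2. `ctK_design_alt_interp`, `ctK_design_alt_semidef_interp` — Part 3a specialised to the design's monomial sequences (Part 2's
   `diagSeq_*` / `linkWeight_*` identities).
3. **`alternatingMinors_of_mem_Icc` — MAXIMALLY-INDEFINITE-INTERVAL THEOREM (all `m`)**: if the leading principal minors of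
   `(c i j · t^(e i j))` satisfy `(−1)^⌊k/2⌋ Δ_k(t) > 0` for all `k ≤ m` at `t = x` and at `t = z` (`0 < x`), then at every `t ∈ [x, z]`;
   i.e. the locus where the LDLᵀ pivots have signs `+, −, +, −, …` (the matrix has `⌊m/2⌋` negative eigenvalues with that pivot pattern —
   for even `m` this is the whole maximally-indefinite locus) is an INTERVAL.
4. **`card_posRoots_topClass_le_two` — TOP-CLASS LAW (even `m`)**: in the α target's own count (`roots.toFinset.filter`), the distinct
   positive roots of `det (C (c i j) · X ^ (e i j))` at which the PROPER leading principal minors alternate, `(−1)^⌊k/2⌋ Δ_k(t) > 0` for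
   `k < m`, number AT MOST TWO.  (For `m = 2n` these are exactly the zeros with `n − 1` negative eigenvalues — the top class, where the
   SMALLEST singular value of the bidiagonal factor crosses `1`.  Proof shape as in Part 2: three such zeros `u₁ < u₂ < u₃`, non-roots
   `y₁ ∈ (u₁,u₂)`, `y₂ ∈ (u₂,u₃)` acquire the full alternating pattern by the semidefinite interpolation, and the strict interpolation
   between `y₁` and `y₂` makes the last pivot at `u₂` negative, contradicting `det = 0`.)
[folklore: continuants / LDLᵀ (Jacobi's signature rule); the interval / top-class statements are this seat's.]
-/

set_option linter.dupNamespace false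
set_option autoImplicit false

namespace Summit.ValiantsHypothesis.ValiantsHypothesis.Theorems.KPlusLogSqLaw.DefiniteInterpolation

open Summit.ValiantsHypothesis.ValiantsHypothesis.Theorems.ValuativeFlip (ctK ctK_zero)
open Polynomial

/-! ### Sign bookkeeping: alternating minors `(−1)^⌊k/2⌋ Δ_k > 0` versus alternating pivots `(−1)^k Δ_(k+1)/Δ_k > 0` -/

/-- Alternating minors give alternating pivots. [folklore: Jacobi's signature rule] -/
theorem pivotSign_of_minorSign (Δ : ℕ → ℝ) (K : ℕ) (h : ∀ k ≤ K, 0 < (-1 : ℝ) ^ (k / 2) * Δ k) :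
    ∀ k < K, 0 < (-1 : ℝ) ^ k * (Δ (k + 1) / Δ k) := by
  intro k hk
  rcases Nat.even_or_odd k with ⟨a, rfl⟩ | ⟨a, rfl⟩
  · have ha := h (a + a) hk.le
    have hb := h (a + a + 1) hk
    rw [show (a + a) / 2 = a by omega] at ha
    rw [show (a + a + 1) / 2 = a by omega] at hb
    rw [Even.neg_one_pow ⟨a, rfl⟩, one_mul, ← mul_div_mul_left _ _ (pow_ne_zero a (by norm_num : (-1 : ℝ) ≠ 0))]
    exact div_pos hb ha
  · have ha := h (2 * a + 1) hk.le
    have hb := h (2 * a + 1 + 1) hk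
    rw [show (2 * a + 1) / 2 = a by omega] at ha
    rw [show (2 * a + 1 + 1) / 2 = a + 1 by omega, pow_succ] at hb
    have hb' : (-1 : ℝ) ^ a * Δ (2 * a + 1 + 1) < 0 := by linarith
    rw [Odd.neg_one_pow ⟨a, rfl⟩, ← mul_div_mul_left _ _ (pow_ne_zero a (by norm_num : (-1 : ℝ) ≠ 0))]
    have := div_neg_of_neg_of_pos hb' ha
    linarith

/-- Alternating pivots give alternating minors (the zeroth minor being `1`). [folklore: Jacobi's signature rule] -/
theorem minorSign_of_pivotSign (Δ : ℕ → ℝ) (K : ℕ) (h0 : Δ 0 = 1)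
    (h : ∀ k < K, 0 < (-1 : ℝ) ^ k * (Δ (k + 1) / Δ k)) :
    ∀ k ≤ K, 0 < (-1 : ℝ) ^ (k / 2) * Δ k := by
  intro k
  induction k with
  | zero => intro _; rw [h0]; norm_num
  | succ k ih =>
    intro hk
    have hprev := ih (by omega)
    have hstep := h k (by omega)
    have hne : Δ k ≠ 0 := (ne_zero_of_sign_div hstep).2
    have hprod := mul_pos hprev hstep
    rcases Nat.even_or_odd k with ⟨a, rfl⟩ | ⟨a, rfl⟩
    · rw [show (a + a) / 2 = a by omega, Even.neg_one_pow ⟨a, rfl⟩, one_mul] at hprod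
      rw [show (a + a + 1) / 2 = a by omega]
      have : (-1 : ℝ) ^ a * Δ (a + a) * (Δ (a + a + 1) / Δ (a + a)) = (-1 : ℝ) ^ a * Δ (a + a + 1) := by
        field_simp
      linarith
    · rw [show (2 * a + 1) / 2 = a by omega, Odd.neg_one_pow ⟨a, rfl⟩] at hprod
      rw [show (2 * a + 1 + 1) / 2 = a + 1 by omega, pow_succ]
      have : (-1 : ℝ) ^ a * Δ (2 * a + 1) * (-1 * (Δ (2 * a + 1 + 1) / Δ (2 * a + 1))) =
          (-1 : ℝ) ^ a * -1 * Δ (2 * a + 1 + 1) := by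
        field_simp
      linarith

/-! ### The alternating pattern for the design -/

section Design

variable {m : ℕ} (c : Fin m → Fin m → ℝ) (e : Fin m → Fin m → ℕ)

/-- **Alternating interpolation for the design's continuants** (any prefix): if `0 < x < y < z` and the pivots alternate for
`k < K` at `x` and at `z`, they alternate at `y`. [this file] -/
theorem ctK_design_alt_interp (hc : ∀ i j, c i j = c j i) (hpos : ∀ i, 0 < c i i)
    {x y z : ℝ} (hx : 0 < x) (hxy : x < y) (hyz : y < z) (K : ℕ)
    (hX : ∀ k < K, 0 < (-1 : ℝ) ^ k * (ctK (fun s : ℕ => if h : s < m then c ⟨s, h⟩ ⟨s, h⟩ * x ^ e ⟨s, h⟩ ⟨s, h⟩ else 1)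
        (fun s : ℕ => -(if h : s + 1 < m then c ⟨s, by omega⟩ ⟨s + 1, h⟩ * x ^ e ⟨s, by omega⟩ ⟨s + 1, h⟩ else 0))
        (fun s : ℕ => if h : 1 ≤ s ∧ s < m then c ⟨s, h.2⟩ ⟨s - 1, by omega⟩ * x ^ e ⟨s, h.2⟩ ⟨s - 1, by omega⟩ else 0) (k + 1) /
        ctK (fun s : ℕ => if h : s < m then c ⟨s, h⟩ ⟨s, h⟩ * x ^ e ⟨s, h⟩ ⟨s, h⟩ else 1)
        (fun s : ℕ => -(if h : s + 1 < m then c ⟨s, by omega⟩ ⟨s + 1, h⟩ * x ^ e ⟨s, by omega⟩ ⟨s + 1, h⟩ else 0))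
        (fun s : ℕ => if h : 1 ≤ s ∧ s < m then c ⟨s, h.2⟩ ⟨s - 1, by omega⟩ * x ^ e ⟨s, h.2⟩ ⟨s - 1, by omega⟩ else 0) k))
    (hZ : ∀ k < K, 0 < (-1 : ℝ) ^ k * (ctK (fun s : ℕ => if h : s < m then c ⟨s, h⟩ ⟨s, h⟩ * z ^ e ⟨s, h⟩ ⟨s, h⟩ else 1)
        (fun s : ℕ => -(if h : s + 1 < m then c ⟨s, by omega⟩ ⟨s + 1, h⟩ * z ^ e ⟨s, by omega⟩ ⟨s + 1, h⟩ else 0))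
        (fun s : ℕ => if h : 1 ≤ s ∧ s < m then c ⟨s, h.2⟩ ⟨s - 1, by omega⟩ * z ^ e ⟨s, h.2⟩ ⟨s - 1, by omega⟩ else 0) (k + 1) /
        ctK (fun s : ℕ => if h : s < m then c ⟨s, h⟩ ⟨s, h⟩ * z ^ e ⟨s, h⟩ ⟨s, h⟩ else 1)
        (fun s : ℕ => -(if h : s + 1 < m then c ⟨s, by omega⟩ ⟨s + 1, h⟩ * z ^ e ⟨s, by omega⟩ ⟨s + 1, h⟩ else 0))
        (fun s : ℕ => if h : 1 ≤ s ∧ s < m then c ⟨s, h.2⟩ ⟨s - 1, by omega⟩ * z ^ e ⟨s, h.2⟩ ⟨s - 1, by omega⟩ else 0) k)) :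
    ∀ k < K, 0 < (-1 : ℝ) ^ k * (ctK (fun s : ℕ => if h : s < m then c ⟨s, h⟩ ⟨s, h⟩ * y ^ e ⟨s, h⟩ ⟨s, h⟩ else 1)
        (fun s : ℕ => -(if h : s + 1 < m then c ⟨s, by omega⟩ ⟨s + 1, h⟩ * y ^ e ⟨s, by omega⟩ ⟨s + 1, h⟩ else 0))
        (fun s : ℕ => if h : 1 ≤ s ∧ s < m then c ⟨s, h.2⟩ ⟨s - 1, by omega⟩ * y ^ e ⟨s, h.2⟩ ⟨s - 1, by omega⟩ else 0) (k + 1) /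
        ctK (fun s : ℕ => if h : s < m then c ⟨s, h⟩ ⟨s, h⟩ * y ^ e ⟨s, h⟩ ⟨s, h⟩ else 1)
        (fun s : ℕ => -(if h : s + 1 < m then c ⟨s, by omega⟩ ⟨s + 1, h⟩ * y ^ e ⟨s, by omega⟩ ⟨s + 1, h⟩ else 0))
        (fun s : ℕ => if h : 1 ≤ s ∧ s < m then c ⟨s, h.2⟩ ⟨s - 1, by omega⟩ * y ^ e ⟨s, h.2⟩ ⟨s - 1, by omega⟩ else 0) k) := by
  have hz : 0 < z := (hx.trans hxy).trans hyz
  obtain ⟨p, q, hp, hq, hpq, hy⟩ := exists_rpow_interp hx hxy hyz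
  subst hy
  exact ctK_alt_pattern_interp hp hq hpq (diagSeq_pos c e hpos hx) (diagSeq_pos c e hpos hz)
    (diagSeq_interp c e hpos hx hz hp hpq) (linkWeight_nonneg c e hc hx) (linkWeight_nonneg c e hc hz)
    (linkWeight_interp c e hc hx hz hp hpq) K hX hZ

/-- **Alternating interpolation, semidefinite top** for the design's continuants. [this file] -/
theorem ctK_design_alt_semidef_interp (hc : ∀ i j, c i j = c j i) (hpos : ∀ i, 0 < c i i)
    {x y z : ℝ} (hx : 0 < x) (hxy : x < y) (hyz : y < z) (i : ℕ)
    (hX : ∀ k ≤ 2 * i, 0 < (-1 : ℝ) ^ k * (ctK (fun s : ℕ => if h : s < m then c ⟨s, h⟩ ⟨s, h⟩ * x ^ e ⟨s, h⟩ ⟨s, h⟩ else 1)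
        (fun s : ℕ => -(if h : s + 1 < m then c ⟨s, by omega⟩ ⟨s + 1, h⟩ * x ^ e ⟨s, by omega⟩ ⟨s + 1, h⟩ else 0))
        (fun s : ℕ => if h : 1 ≤ s ∧ s < m then c ⟨s, h.2⟩ ⟨s - 1, by omega⟩ * x ^ e ⟨s, h.2⟩ ⟨s - 1, by omega⟩ else 0) (k + 1) /
        ctK (fun s : ℕ => if h : s < m then c ⟨s, h⟩ ⟨s, h⟩ * x ^ e ⟨s, h⟩ ⟨s, h⟩ else 1)
        (fun s : ℕ => -(if h : s + 1 < m then c ⟨s, by omega⟩ ⟨s + 1, h⟩ * x ^ e ⟨s, by omega⟩ ⟨s + 1, h⟩ else 0))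
        (fun s : ℕ => if h : 1 ≤ s ∧ s < m then c ⟨s, h.2⟩ ⟨s - 1, by omega⟩ * x ^ e ⟨s, h.2⟩ ⟨s - 1, by omega⟩ else 0) k))
    (hZ : ∀ k ≤ 2 * i, 0 < (-1 : ℝ) ^ k * (ctK (fun s : ℕ => if h : s < m then c ⟨s, h⟩ ⟨s, h⟩ * z ^ e ⟨s, h⟩ ⟨s, h⟩ else 1)
        (fun s : ℕ => -(if h : s + 1 < m then c ⟨s, by omega⟩ ⟨s + 1, h⟩ * z ^ e ⟨s, by omega⟩ ⟨s + 1, h⟩ else 0))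
        (fun s : ℕ => if h : 1 ≤ s ∧ s < m then c ⟨s, h.2⟩ ⟨s - 1, by omega⟩ * z ^ e ⟨s, h.2⟩ ⟨s - 1, by omega⟩ else 0) (k + 1) /
        ctK (fun s : ℕ => if h : s < m then c ⟨s, h⟩ ⟨s, h⟩ * z ^ e ⟨s, h⟩ ⟨s, h⟩ else 1)
        (fun s : ℕ => -(if h : s + 1 < m then c ⟨s, by omega⟩ ⟨s + 1, h⟩ * z ^ e ⟨s, by omega⟩ ⟨s + 1, h⟩ else 0))
        (fun s : ℕ => if h : 1 ≤ s ∧ s < m then c ⟨s, h.2⟩ ⟨s - 1, by omega⟩ * z ^ e ⟨s, h.2⟩ ⟨s - 1, by omega⟩ else 0) k))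
    (hXs : ctK (fun s : ℕ => if h : s < m then c ⟨s, h⟩ ⟨s, h⟩ * x ^ e ⟨s, h⟩ ⟨s, h⟩ else 1)
        (fun s : ℕ => -(if h : s + 1 < m then c ⟨s, by omega⟩ ⟨s + 1, h⟩ * x ^ e ⟨s, by omega⟩ ⟨s + 1, h⟩ else 0))
        (fun s : ℕ => if h : 1 ≤ s ∧ s < m then c ⟨s, h.2⟩ ⟨s - 1, by omega⟩ * x ^ e ⟨s, h.2⟩ ⟨s - 1, by omega⟩ else 0) (2 * i + 2) /
        ctK (fun s : ℕ => if h : s < m then c ⟨s, h⟩ ⟨s, h⟩ * x ^ e ⟨s, h⟩ ⟨s, h⟩ else 1)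
        (fun s : ℕ => -(if h : s + 1 < m then c ⟨s, by omega⟩ ⟨s + 1, h⟩ * x ^ e ⟨s, by omega⟩ ⟨s + 1, h⟩ else 0))
        (fun s : ℕ => if h : 1 ≤ s ∧ s < m then c ⟨s, h.2⟩ ⟨s - 1, by omega⟩ * x ^ e ⟨s, h.2⟩ ⟨s - 1, by omega⟩ else 0) (2 * i + 1) ≤ 0)
    (hZs : ctK (fun s : ℕ => if h : s < m then c ⟨s, h⟩ ⟨s, h⟩ * z ^ e ⟨s, h⟩ ⟨s, h⟩ else 1)
        (fun s : ℕ => -(if h : s + 1 < m then c ⟨s, by omega⟩ ⟨s + 1, h⟩ * z ^ e ⟨s, by omega⟩ ⟨s + 1, h⟩ else 0))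
        (fun s : ℕ => if h : 1 ≤ s ∧ s < m then c ⟨s, h.2⟩ ⟨s - 1, by omega⟩ * z ^ e ⟨s, h.2⟩ ⟨s - 1, by omega⟩ else 0) (2 * i + 2) /
        ctK (fun s : ℕ => if h : s < m then c ⟨s, h⟩ ⟨s, h⟩ * z ^ e ⟨s, h⟩ ⟨s, h⟩ else 1)
        (fun s : ℕ => -(if h : s + 1 < m then c ⟨s, by omega⟩ ⟨s + 1, h⟩ * z ^ e ⟨s, by omega⟩ ⟨s + 1, h⟩ else 0))
        (fun s : ℕ => if h : 1 ≤ s ∧ s < m then c ⟨s, h.2⟩ ⟨s - 1, by omega⟩ * z ^ e ⟨s, h.2⟩ ⟨s - 1, by omega⟩ else 0) (2 * i + 1) ≤ 0) :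
    (∀ k ≤ 2 * i, 0 < (-1 : ℝ) ^ k * (ctK (fun s : ℕ => if h : s < m then c ⟨s, h⟩ ⟨s, h⟩ * y ^ e ⟨s, h⟩ ⟨s, h⟩ else 1)
        (fun s : ℕ => -(if h : s + 1 < m then c ⟨s, by omega⟩ ⟨s + 1, h⟩ * y ^ e ⟨s, by omega⟩ ⟨s + 1, h⟩ else 0))
        (fun s : ℕ => if h : 1 ≤ s ∧ s < m then c ⟨s, h.2⟩ ⟨s - 1, by omega⟩ * y ^ e ⟨s, h.2⟩ ⟨s - 1, by omega⟩ else 0) (k + 1) /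
        ctK (fun s : ℕ => if h : s < m then c ⟨s, h⟩ ⟨s, h⟩ * y ^ e ⟨s, h⟩ ⟨s, h⟩ else 1)
        (fun s : ℕ => -(if h : s + 1 < m then c ⟨s, by omega⟩ ⟨s + 1, h⟩ * y ^ e ⟨s, by omega⟩ ⟨s + 1, h⟩ else 0))
        (fun s : ℕ => if h : 1 ≤ s ∧ s < m then c ⟨s, h.2⟩ ⟨s - 1, by omega⟩ * y ^ e ⟨s, h.2⟩ ⟨s - 1, by omega⟩ else 0) k)) ∧
      ctK (fun s : ℕ => if h : s < m then c ⟨s, h⟩ ⟨s, h⟩ * y ^ e ⟨s, h⟩ ⟨s, h⟩ else 1)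
        (fun s : ℕ => -(if h : s + 1 < m then c ⟨s, by omega⟩ ⟨s + 1, h⟩ * y ^ e ⟨s, by omega⟩ ⟨s + 1, h⟩ else 0))
        (fun s : ℕ => if h : 1 ≤ s ∧ s < m then c ⟨s, h.2⟩ ⟨s - 1, by omega⟩ * y ^ e ⟨s, h.2⟩ ⟨s - 1, by omega⟩ else 0) (2 * i + 2) /
        ctK (fun s : ℕ => if h : s < m then c ⟨s, h⟩ ⟨s, h⟩ * y ^ e ⟨s, h⟩ ⟨s, h⟩ else 1)
        (fun s : ℕ => -(if h : s + 1 < m then c ⟨s, by omega⟩ ⟨s + 1, h⟩ * y ^ e ⟨s, by omega⟩ ⟨s + 1, h⟩ else 0))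
        (fun s : ℕ => if h : 1 ≤ s ∧ s < m then c ⟨s, h.2⟩ ⟨s - 1, by omega⟩ * y ^ e ⟨s, h.2⟩ ⟨s - 1, by omega⟩ else 0) (2 * i + 1) ≤ 0 := by
  have hz : 0 < z := (hx.trans hxy).trans hyz
  obtain ⟨p, q, hp, hq, hpq, hy⟩ := exists_rpow_interp hx hxy hyz
  subst hy
  exact ctK_alt_semidef_interp hp hq hpq (diagSeq_pos c e hpos hx) (diagSeq_pos c e hpos hz)
    (diagSeq_interp c e hpos hx hz hp hpq) (linkWeight_nonneg c e hc hx) (linkWeight_nonneg c e hc hz)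
    (linkWeight_interp c e hc hx hz hp hpq) i hX hZ hXs hZs

end Design

/-! ### The two theorems in the currency of the typed α target (lead R2102/R2114) -/

section Target

variable {m : ℕ} (c : Fin m → Fin m → ℝ) (e : Fin m → Fin m → ℕ)

/-- **MAXIMALLY-INDEFINITE-INTERVAL THEOREM (all sizes).**  For a static definite tridiagonal design, if the leading principal
minors of `(c i j · t ^ (e i j))` ALTERNATE in the pattern `(−1)^⌊k/2⌋ Δ_k(t) > 0` (`k = 0, …, m`; i.e. the LDLᵀ pivots have the
signs `+, −, +, −, …`, the matrix has the maximal number `⌊m/2⌋` of negative eigenvalues, by Jacobi's signature rule) at `t = x` and at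
`t = z` (`0 < x`), then they do so at every `y ∈ [x, z]`: that locus is an INTERVAL.  Mechanism: along `y = x^(1−θ) z^θ` the
odd-indexed pivots are log-convex and the even-indexed ones log-concave in absolute value. [this file] -/
theorem alternatingMinors_of_mem_Icc (hc : ∀ i j, c i j = c j i)
    (hband : ∀ i j : Fin m, (i : ℕ) + 1 < j ∨ (j : ℕ) + 1 < i → c i j = 0) (hpos : ∀ i, 0 < c i i)
    {x y z : ℝ} (hx : 0 < x) (hxy : x ≤ y) (hyz : y ≤ z)
    (hX : ∀ (k : ℕ) (hk : k ≤ m), 0 < (-1 : ℝ) ^ (k / 2) * (Matrix.of fun i j : Fin k => c (Fin.castLE hk i) (Fin.castLE hk j) * x ^ e (Fin.castLE hk i) (Fin.castLE hk j)).det)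
    (hZ : ∀ (k : ℕ) (hk : k ≤ m), 0 < (-1 : ℝ) ^ (k / 2) * (Matrix.of fun i j : Fin k => c (Fin.castLE hk i) (Fin.castLE hk j) * z ^ e (Fin.castLE hk i) (Fin.castLE hk j)).det) :
    ∀ (k : ℕ) (hk : k ≤ m), 0 < (-1 : ℝ) ^ (k / 2) * (Matrix.of fun i j : Fin k => c (Fin.castLE hk i) (Fin.castLE hk j) * y ^ e (Fin.castLE hk i) (Fin.castLE hk j)).det := by
  rcases hxy.eq_or_lt with hxy' | hxy'
  · subst hxy'; exact hX
  rcases hyz.eq_or_lt with hyz' | hyz'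
  · subst hyz'; exact hZ
  -- pass to the continuant sequences (values beyond `m` are irrelevant but well defined)
  have hX' : ∀ k ≤ m, 0 < (-1 : ℝ) ^ (k / 2) * ctK (fun s : ℕ => if h : s < m then c ⟨s, h⟩ ⟨s, h⟩ * x ^ e ⟨s, h⟩ ⟨s, h⟩ else 1)
        (fun s : ℕ => -(if h : s + 1 < m then c ⟨s, by omega⟩ ⟨s + 1, h⟩ * x ^ e ⟨s, by omega⟩ ⟨s + 1, h⟩ else 0))
        (fun s : ℕ => if h : 1 ≤ s ∧ s < m then c ⟨s, h.2⟩ ⟨s - 1, by omega⟩ * x ^ e ⟨s, h.2⟩ ⟨s - 1, by omega⟩ else 0) k := by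
    intro k hk; rw [← det_leadingBlock_eq_ctK c e hband x hk]; exact hX k hk
  have hZ' : ∀ k ≤ m, 0 < (-1 : ℝ) ^ (k / 2) * ctK (fun s : ℕ => if h : s < m then c ⟨s, h⟩ ⟨s, h⟩ * z ^ e ⟨s, h⟩ ⟨s, h⟩ else 1)
        (fun s : ℕ => -(if h : s + 1 < m then c ⟨s, by omega⟩ ⟨s + 1, h⟩ * z ^ e ⟨s, by omega⟩ ⟨s + 1, h⟩ else 0))
        (fun s : ℕ => if h : 1 ≤ s ∧ s < m then c ⟨s, h.2⟩ ⟨s - 1, by omega⟩ * z ^ e ⟨s, h.2⟩ ⟨s - 1, by omega⟩ else 0) k := by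
    intro k hk; rw [← det_leadingBlock_eq_ctK c e hband z hk]; exact hZ k hk
  have hY' := minorSign_of_pivotSign _ m (ctK_zero _ _ _)
    (ctK_design_alt_interp c e hc hpos hx hxy' hyz' m (pivotSign_of_minorSign _ m hX') (pivotSign_of_minorSign _ m hZ'))
  intro k hk
  rw [det_leadingBlock_eq_ctK c e hband y hk]
  exact hY' k hk

/-- **TOP-CLASS LAW (even sizes): at most TWO positive determinant zeros in the top inertia class.**  For a static definite
tridiagonal design of EVEN size `m = 2n`, the number of distinct positive roots `t` of `det (C (c i j) · X ^ (e i j))` at which the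
PROPER leading principal minors of the real matrix alternate, `(−1)^⌊k/2⌋ Δ_k(t) > 0` for `k < m` (by Jacobi's signature rule: at
which the singular matrix has exactly `n − 1` negative eigenvalues, the maximum for a singular `2n × 2n` matrix of this kind — the TOP
inertia class `Z_(n−1)`, i.e. the zero that crosses is the SMALLEST singular value of the bidiagonal factor), is at most `2`, in the
count `roots.toFinset.filter` of the typed α target.  Together with `card_posRoots_bottomClass_le_two`: for every even size BOTH extreme
inertia classes carry at most two zeros each. [this file] -/
theorem card_posRoots_topClass_le_two (hm : Even m) (hc : ∀ i j, c i j = c j i)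
    (hband : ∀ i j : Fin m, (i : ℕ) + 1 < j ∨ (j : ℕ) + 1 < i → c i j = 0) (hpos : ∀ i, 0 < c i i) :
    ((Matrix.det (Matrix.of fun i j => C (c i j) * (X : ℝ[X]) ^ e i j)).roots.toFinset.filter
      (fun t : ℝ => 0 < t ∧ ∀ (k : ℕ) (hk : k < m),
        0 < (-1 : ℝ) ^ (k / 2) * (Matrix.of fun i j : Fin k => c (Fin.castLE hk.le i) (Fin.castLE hk.le j) * t ^ e (Fin.castLE hk.le i) (Fin.castLE hk.le j)).det)).card ≤ 2 := by
  set P : ℝ[X] := Matrix.det (Matrix.of fun i j => C (c i j) * (X : ℝ[X]) ^ e i j) with hP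
  set S := P.roots.toFinset.filter (fun t : ℝ => 0 < t ∧ ∀ (k : ℕ) (hk : k < m),
        0 < (-1 : ℝ) ^ (k / 2) * (Matrix.of fun i j : Fin k => c (Fin.castLE hk.le i) (Fin.castLE hk.le j) * t ^ e (Fin.castLE hk.le i) (Fin.castLE hk.le j)).det) with hS
  by_contra hcard
  rw [not_le] at hcard
  have hne : S.Nonempty := Finset.card_pos.mp (by omega)
  -- an even size with a root is `m = 2 i + 2`
  obtain ⟨i, hi⟩ : ∃ i : ℕ, m = 2 * i + 2 := by
    obtain ⟨n, hn⟩ := hm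
    rcases n with _ | i
    · exfalso
      obtain ⟨t, ht⟩ := hne
      rw [hS, Finset.mem_filter, Multiset.mem_toFinset, Polynomial.mem_roots'] at ht
      obtain ⟨⟨hP0, hroot⟩, -, -⟩ := ht
      apply hP0
      -- hmm: for `m = 0` the determinant is `1`, which has no roots
      have h1 : P = 1 := by
        rw [hP]
        have : m = 0 := by omega
        subst this
        exact Matrix.det_isEmpty
      rw [h1] at hroot
      simp at hroot
    · exact ⟨i, by omega⟩
  -- unpack membership: alternating pivots for k ≤ 2i, and the last continuant vanishes
  have hmem : ∀ t ∈ S, P ≠ 0 ∧ 0 < t ∧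
      (∀ k ≤ 2 * i, 0 < (-1 : ℝ) ^ k * (ctK (fun s : ℕ => if h : s < m then c ⟨s, h⟩ ⟨s, h⟩ * t ^ e ⟨s, h⟩ ⟨s, h⟩ else 1)
        (fun s : ℕ => -(if h : s + 1 < m then c ⟨s, by omega⟩ ⟨s + 1, h⟩ * t ^ e ⟨s, by omega⟩ ⟨s + 1, h⟩ else 0))
        (fun s : ℕ => if h : 1 ≤ s ∧ s < m then c ⟨s, h.2⟩ ⟨s - 1, by omega⟩ * t ^ e ⟨s, h.2⟩ ⟨s - 1, by omega⟩ else 0) (k + 1) /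
        ctK (fun s : ℕ => if h : s < m then c ⟨s, h⟩ ⟨s, h⟩ * t ^ e ⟨s, h⟩ ⟨s, h⟩ else 1)
        (fun s : ℕ => -(if h : s + 1 < m then c ⟨s, by omega⟩ ⟨s + 1, h⟩ * t ^ e ⟨s, by omega⟩ ⟨s + 1, h⟩ else 0))
        (fun s : ℕ => if h : 1 ≤ s ∧ s < m then c ⟨s, h.2⟩ ⟨s - 1, by omega⟩ * t ^ e ⟨s, h.2⟩ ⟨s - 1, by omega⟩ else 0) k)) ∧
      ctK (fun s : ℕ => if h : s < m then c ⟨s, h⟩ ⟨s, h⟩ * t ^ e ⟨s, h⟩ ⟨s, h⟩ else 1)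
        (fun s : ℕ => -(if h : s + 1 < m then c ⟨s, by omega⟩ ⟨s + 1, h⟩ * t ^ e ⟨s, by omega⟩ ⟨s + 1, h⟩ else 0))
        (fun s : ℕ => if h : 1 ≤ s ∧ s < m then c ⟨s, h.2⟩ ⟨s - 1, by omega⟩ * t ^ e ⟨s, h.2⟩ ⟨s - 1, by omega⟩ else 0) (2 * i + 2) = 0 := by
    intro t ht
    rw [hS, Finset.mem_filter, Multiset.mem_toFinset, Polynomial.mem_roots'] at ht
    obtain ⟨⟨hP0, hroot⟩, ht0, hmin⟩ := ht
    refine ⟨hP0, ht0, ?_, ?_⟩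
    · have hmin' : ∀ k ≤ 2 * i + 1, 0 < (-1 : ℝ) ^ (k / 2) * ctK (fun s : ℕ => if h : s < m then c ⟨s, h⟩ ⟨s, h⟩ * t ^ e ⟨s, h⟩ ⟨s, h⟩ else 1)
        (fun s : ℕ => -(if h : s + 1 < m then c ⟨s, by omega⟩ ⟨s + 1, h⟩ * t ^ e ⟨s, by omega⟩ ⟨s + 1, h⟩ else 0))
        (fun s : ℕ => if h : 1 ≤ s ∧ s < m then c ⟨s, h.2⟩ ⟨s - 1, by omega⟩ * t ^ e ⟨s, h.2⟩ ⟨s - 1, by omega⟩ else 0) k := by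
        intro k hk
        rw [← det_leadingBlock_eq_ctK c e hband t (show k ≤ m by omega)]
        exact hmin k (by omega)
      intro k hk
      exact pivotSign_of_minorSign _ (2 * i + 1) hmin' k (by omega)
    · rw [← hi, ← det_design_eq_ctK c e hband t, ← eval_det_design c e t]; exact hroot
  -- a non-root strictly between two members has the FULL alternating pivot pattern (k ≤ 2i+1)
  have hgap : ∀ u ∈ S, ∀ v ∈ S, ∀ w : ℝ, u < w → w < v → w ∉ P.roots.toFinset →
      ∀ k ≤ 2 * i + 1, 0 < (-1 : ℝ) ^ k * (ctK (fun s : ℕ => if h : s < m then c ⟨s, h⟩ ⟨s, h⟩ * w ^ e ⟨s, h⟩ ⟨s, h⟩ else 1)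
        (fun s : ℕ => -(if h : s + 1 < m then c ⟨s, by omega⟩ ⟨s + 1, h⟩ * w ^ e ⟨s, by omega⟩ ⟨s + 1, h⟩ else 0))
        (fun s : ℕ => if h : 1 ≤ s ∧ s < m then c ⟨s, h.2⟩ ⟨s - 1, by omega⟩ * w ^ e ⟨s, h.2⟩ ⟨s - 1, by omega⟩ else 0) (k + 1) /
        ctK (fun s : ℕ => if h : s < m then c ⟨s, h⟩ ⟨s, h⟩ * w ^ e ⟨s, h⟩ ⟨s, h⟩ else 1)
        (fun s : ℕ => -(if h : s + 1 < m then c ⟨s, by omega⟩ ⟨s + 1, h⟩ * w ^ e ⟨s, by omega⟩ ⟨s + 1, h⟩ else 0))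
        (fun s : ℕ => if h : 1 ≤ s ∧ s < m then c ⟨s, h.2⟩ ⟨s - 1, by omega⟩ * w ^ e ⟨s, h.2⟩ ⟨s - 1, by omega⟩ else 0) k) := by
    intro u hu v hv w huw hwv hw
    obtain ⟨hP0, hu0, huK, hum⟩ := hmem u hu
    obtain ⟨-, -, hvK, hvm⟩ := hmem v hv
    obtain ⟨hlt, hle⟩ := ctK_design_alt_semidef_interp c e hc hpos hu0 huw hwv i huK hvK
      (by rw [hum, zero_div]) (by rw [hvm, zero_div])
    have hne : ctK (fun s : ℕ => if h : s < m then c ⟨s, h⟩ ⟨s, h⟩ * w ^ e ⟨s, h⟩ ⟨s, h⟩ else 1)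
        (fun s : ℕ => -(if h : s + 1 < m then c ⟨s, by omega⟩ ⟨s + 1, h⟩ * w ^ e ⟨s, by omega⟩ ⟨s + 1, h⟩ else 0))
        (fun s : ℕ => if h : 1 ≤ s ∧ s < m then c ⟨s, h.2⟩ ⟨s - 1, by omega⟩ * w ^ e ⟨s, h.2⟩ ⟨s - 1, by omega⟩ else 0) (2 * i + 2) ≠ 0 := by
      intro h0
      rw [← hi] at h0
      apply hw
      rw [Multiset.mem_toFinset, Polynomial.mem_roots hP0, Polynomial.IsRoot.def, eval_det_design c e w,
        det_design_eq_ctK c e hband w]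
      exact h0
    have hne' : ctK (fun s : ℕ => if h : s < m then c ⟨s, h⟩ ⟨s, h⟩ * w ^ e ⟨s, h⟩ ⟨s, h⟩ else 1)
        (fun s : ℕ => -(if h : s + 1 < m then c ⟨s, by omega⟩ ⟨s + 1, h⟩ * w ^ e ⟨s, by omega⟩ ⟨s + 1, h⟩ else 0))
        (fun s : ℕ => if h : 1 ≤ s ∧ s < m then c ⟨s, h.2⟩ ⟨s - 1, by omega⟩ * w ^ e ⟨s, h.2⟩ ⟨s - 1, by omega⟩ else 0) (2 * i + 1) ≠ 0 :=
      (ne_zero_of_sign_div (hlt (2 * i) le_rfl)).1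
    intro k hk
    rcases Nat.lt_or_ge k (2 * i + 1) with h | h
    · exact hlt k (by omega)
    · have hk' : k = 2 * i + 1 := by omega
      subst hk'
      rw [pow_succ, pow_mul, neg_one_sq, one_pow, one_mul]
      have hlt' : ctK (fun s : ℕ => if h : s < m then c ⟨s, h⟩ ⟨s, h⟩ * w ^ e ⟨s, h⟩ ⟨s, h⟩ else 1)
        (fun s : ℕ => -(if h : s + 1 < m then c ⟨s, by omega⟩ ⟨s + 1, h⟩ * w ^ e ⟨s, by omega⟩ ⟨s + 1, h⟩ else 0))
        (fun s : ℕ => if h : 1 ≤ s ∧ s < m then c ⟨s, h.2⟩ ⟨s - 1, by omega⟩ * w ^ e ⟨s, h.2⟩ ⟨s - 1, by omega⟩ else 0) (2 * i + 2) /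
          ctK (fun s : ℕ => if h : s < m then c ⟨s, h⟩ ⟨s, h⟩ * w ^ e ⟨s, h⟩ ⟨s, h⟩ else 1)
        (fun s : ℕ => -(if h : s + 1 < m then c ⟨s, by omega⟩ ⟨s + 1, h⟩ * w ^ e ⟨s, by omega⟩ ⟨s + 1, h⟩ else 0))
        (fun s : ℕ => if h : 1 ≤ s ∧ s < m then c ⟨s, h.2⟩ ⟨s - 1, by omega⟩ * w ^ e ⟨s, h.2⟩ ⟨s - 1, by omega⟩ else 0) (2 * i + 1) < 0 :=
        lt_of_le_of_ne hle (div_ne_zero hne hne')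
      linarith
  -- three members x < y < z
  set x := S.min' hne with hx
  set z := S.max' hne with hz
  have hxS : x ∈ S := Finset.min'_mem S hne
  have hzS : z ∈ S := Finset.max'_mem S hne
  have hcard' : 0 < ((S.erase x).erase z).card := by
    have h1 : (S.erase x).card = S.card - 1 := Finset.card_erase_of_mem hxS
    have h2 : (S.erase x).card - 1 ≤ ((S.erase x).erase z).card := Finset.pred_card_le_card_erase
    omega
  obtain ⟨y, hy⟩ := Finset.card_pos.mp hcard'
  rw [Finset.mem_erase, Finset.mem_erase] at hy
  obtain ⟨hyz, hyx, hyS⟩ := hy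
  have hxy : x < y := lt_of_le_of_ne (Finset.min'_le S y hyS) (Ne.symm hyx)
  have hyz' : y < z := lt_of_le_of_ne (Finset.le_max' S y hyS) hyz
  obtain ⟨y₁, hy₁, hy₁r⟩ := Set.Infinite.exists_notMem_finset (Set.Ioo_infinite hxy) P.roots.toFinset
  obtain ⟨y₂, hy₂, hy₂r⟩ := Set.Infinite.exists_notMem_finset (Set.Ioo_infinite hyz') P.roots.toFinset
  have h₁ := hgap x hxS y hyS y₁ hy₁.1 hy₁.2 hy₁r
  have h₂ := hgap y hyS z hzS y₂ hy₂.1 hy₂.2 hy₂r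
  obtain ⟨-, hx0, -, -⟩ := hmem x hxS
  obtain ⟨-, -, -, hym⟩ := hmem y hyS
  have hy₁0 : 0 < y₁ := hx0.trans hy₁.1
  have hfull := ctK_design_alt_interp c e hc hpos hy₁0 hy₁.2 hy₂.1 (2 * i + 2) (fun k hk => h₁ k (by omega))
    (fun k hk => h₂ k (by omega)) (2 * i + 1) (by omega)
  have := (ne_zero_of_sign_div hfull).1
  exact this hym

end Target

end Summit.ValiantsHypothesis.ValiantsHypothesis.Theorems.KPlusLogSqLaw.DefiniteInterpolation
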